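import Mathlib.Analysis.Complex.Polynomial.Basic
import Mathlib.Algebra.CharZero.Infinite
import Literature.NumberTheory.Transcendental.WeakCITLattice
import Literature.NumberTheory.Transcendental.ExpVarietiesDimension
import HarnessLib

/-!
# Weak CIT, step 4b: the dimension of a torus coset

Support file for the discharge of `Literature.NumberTheory.Transcendental.weakCIT`
(`IntersectionsWithTori.lean`). For a coset `T = c · H_Λ ⊆ (ℂˣ)ⁿ` of the algebraic torus of a
pure lattice `Λ ≤ ℤⁿ` we prove the dimension estimate actually used in the weak CIT argument,
`dim T ≥ n - rk Λ` (Bombieri–Gubler, Prop. 3.2.7: "`H_Λ` is an algebraic subgroup of dimension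
`r`" for `rk Λ = n - r`), in the form

* `exists_unimodular_le_zariskiDim`: there are mutually inverse integer matrices `U, U'` and
  indices `J` with the rows `Uⱼ ∈ Λ` (`j ∈ J`) and `n ≤ zariskiDim ℂ T + |J|`.

The dimension (`Literature.NumberTheory.Transcendental.zariskiDim` = Krull dimension of the
coordinate ring `ℂ[Y] ⧸ I(T)` of the closure) is bounded below through the monomial
parametrisation `τ = c · s^{U'}`, `s = (1_J, X_{Jᶜ})`, with values in the rational function field
`E = ℂ(X₁, …, Xₙ)`: every polynomial vanishing on `T` vanishes at `τ` (`aeval_paramPt_eq_zero`,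
by clearing denominators and Zariski density of `(ℂˣ)ⁿ` in `ℂⁿ`), so
`dim T ≥ dim ℂ[Y]/ker = trdeg_ℂ ℂ[τ]`, and `ℂ[τ, s]` is algebraic over `ℂ[τ]`
(`s_i = κᵢ ∏ₗ τₗ^{Uᵢₗ}`) and contains the `n - |J|` algebraically independent `Xⱼ`, `j ∉ J`
(`le_trdeg_adjoin_paramPt`).

## References

* E. Bombieri, W. Gubler, *Heights in Diophantine Geometry*, CUP 2006, Prop. 3.2.7.
* H. Matsumura, *Commutative Ring Theory*, CUP 1986, Thm 5.6 (dimension = transcendence degree).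
-/

noncomputable section

open MvPolynomial Set Cardinal

namespace Literature.NumberTheory.Transcendental.WeakCIT

variable {n : ℕ}

/-! ### The monomial parametrisation with values in `ℂ(X₁, …, Xₙ)` -/

section Param

variable (U' : Matrix (Fin n) (Fin n) ℤ) (J : Finset (Fin n)) (c : Fin n → ℂ)

/-- The rational function field `E = ℂ(X₁, …, Xₙ)`. [folklore] -/
abbrev ParamField (n : ℕ) : Type := FractionRing (MvPolynomial (Fin n) ℂ)

/-- The substitution `Xⱼ ↦ 1` (`j ∈ J`), `Xⱼ ↦ Xⱼ` (`j ∉ J`). [folklore] -/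
def substJ (j : Fin n) : MvPolynomial (Fin n) ℂ := if j ∈ J then 1 else X j

/-- The parameters `s = (1_J, X_{Jᶜ}) ∈ Eⁿ`. [folklore] -/
def paramS (j : Fin n) : ParamField n :=
  algebraMap (MvPolynomial (Fin n) ℂ) (ParamField n) (substJ J j)

/-- The monomial parametrisation `τₗ = cₗ ∏ⱼ sⱼ ^ U'ₗⱼ` of the coset `c · H_Λ`.
[cite: BombieriGubler2006, Prop. 3.2.7 (proof)] -/
def paramPt (l : Fin n) : ParamField n :=
  algebraMap ℂ (ParamField n) (c l) * ∏ j, paramS J j ^ U' l j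

/-- `sⱼ = 1` for `j ∈ J`. [folklore] -/
theorem paramS_of_mem {j : Fin n} (hj : j ∈ J) : paramS J j = 1 := by
  simp [paramS, substJ, hj]

/-- `sⱼ = Xⱼ` for `j ∉ J`. [folklore] -/
theorem paramS_of_not_mem {j : Fin n} (hj : j ∉ J) :
    paramS J j = algebraMap (MvPolynomial (Fin n) ℂ) (ParamField n) (X j) := by
  simp [paramS, substJ, hj]

/-- The parameters are non-zero. [folklore] -/
theorem paramS_ne_zero (j : Fin n) : paramS J j ≠ 0 := by
  by_cases hj : j ∈ J
  · rw [paramS_of_mem J hj]; exact one_ne_zero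
  · rw [paramS_of_not_mem J hj, map_ne_zero_iff _ (IsFractionRing.injective _ _)]
    exact X_ne_zero j

/-- Evaluating at `s` is substituting and embedding. [folklore] -/
theorem aeval_paramS (a : MvPolynomial (Fin n) ℂ) :
    aeval (paramS J) a = algebraMap (MvPolynomial (Fin n) ℂ) (ParamField n) (aeval (substJ J) a) := by
  have h : (aeval (paramS J) : MvPolynomial (Fin n) ℂ →ₐ[ℂ] ParamField n) =
      (IsScalarTower.toAlgHom ℂ (MvPolynomial (Fin n) ℂ) (ParamField n)).comp (aeval (substJ J)) :=
    MvPolynomial.algHom_ext fun j => by simp [paramS]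
  rw [h]
  rfl

variable {U' J c}

/-- **Density step**: a polynomial vanishing on the coset `c · H_Λ` vanishes at the parametrising
point `τ ∈ Eⁿ` (with `U, U', J, Λ` as in `exists_unimodular`). Clearing denominators,
`p(c · z^{U'}) (∏ z)^N = a(z)` uniformly in `z`; at points `z = (1_J, b_{Jᶜ})`, `b ∈ (ℂˣ)ⁿ`, the
left side vanishes because `c · z^{U'} ∈ c · H_Λ`, so `a(1_J, X_{Jᶜ}) · ∏ Xⱼ` vanishes on `ℂⁿ` and
is `0`; then evaluate at `z = s`. [cite: BombieriGubler2006, Prop. 3.2.7 (proof)] -/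
theorem aeval_paramPt_eq_zero {U : Matrix (Fin n) (Fin n) ℤ} {Λ : AddSubgroup (Fin n → ℤ)}
    (hUU' : U * U' = 1) (hΛ : Λ = AddSubgroup.closure ((fun j => U j) '' (J : Set (Fin n))))
    {p : MvPolynomial (Fin n) ℂ}
    (hp : p ∈ vanishingIdeal ℂ ((fun h => c * h) '' subgroupOfLattice ℂ Λ)) :
    aeval (paramPt U' J c) p = 0 := by
  classical
  obtain ⟨N, a, hNa⟩ := exists_mul_prod_pow_eq_aeval_monomial U' c p
  -- Step A: `a(1_J, X_{Jᶜ}) = 0`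
  have hã : aeval (substJ J) a = 0 := by
    have hzero : aeval (substJ J) a * ∏ j, X j = 0 := by
      apply MvPolynomial.funext
      intro b
      rw [map_mul, map_zero, map_prod]
      simp only [MvPolynomial.eval_X]
      by_cases hb : ∀ j, b j ≠ 0
      · set b' : Fin n → ℂ := fun j => if j ∈ J then 1 else b j with hb'def
        have hb' : ∀ j, b' j ≠ 0 := fun j => by
          by_cases hj : j ∈ J <;> simp [hb'def, hj, hb j]
        have hb'J : ∀ j ∈ J, b' j = 1 := fun j hj => by simp [hb'def, hj]
        have heval : eval b (aeval (substJ J) a) = aeval b' a := by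
          rw [← coe_aeval_eq_eval]
          show aeval b (aeval (substJ J) a) = aeval b' a
          rw [← AlgHom.comp_apply, MvPolynomial.comp_aeval]
          have hfun : (fun i => aeval b (substJ J i)) = b' := by
            funext j
            by_cases hj : j ∈ J <;> simp [substJ, hb'def, hj]
          rw [hfun]
        have hT : (fun l => algebraMap ℂ ℂ (c l) * ∏ j, b' j ^ U' l j) ∈
            (fun h => c * h) '' subgroupOfLattice ℂ Λ :=
          ⟨fun l => ∏ j, b' j ^ U' l j, monomial_mem_subgroupOfLattice hUU' hΛ b' hb' hb'J,
            by funext l; simp⟩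
        have hp0 := (mem_vanishingIdeal_iff.mp hp) _ hT
        rw [heval, ← hNa b' hb', hp0, zero_mul, zero_mul]
      · push Not at hb
        obtain ⟨j, hj⟩ := hb
        rw [Finset.prod_eq_zero (Finset.mem_univ j) hj, mul_zero]
    exact (mul_eq_zero.mp hzero).resolve_right
      (Finset.prod_ne_zero_iff.mpr fun j _ => X_ne_zero j)
  -- Step B: evaluate the identity at `z = s`
  have h := hNa (paramS J) (paramS_ne_zero J)
  rw [aeval_paramS, hã, map_zero] at h
  exact (mul_eq_zero.mp h).resolve_right
    (pow_ne_zero _ (Finset.prod_ne_zero_iff.mpr fun j _ => paramS_ne_zero J j))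

/-- Integer powers of algebraic elements of a field are algebraic. [folklore] -/
theorem isAlgebraic_zpow {R K : Type*} [CommRing R] [NoZeroDivisors R] [Field K] [Algebra R K]
    {a : K} (ha : IsAlgebraic R a) (z : ℤ) : IsAlgebraic R (a ^ z) := by
  cases z with
  | ofNat m => simpa using ha.pow m
  | negSucc m => rw [zpow_negSucc]; exact (ha.pow _).inv

/-- Finite products of algebraic elements are algebraic. [folklore] -/
theorem isAlgebraic_finset_prod {R K ι : Type*} [CommRing R] [NoZeroDivisors R] [Nontrivial R]
    [Field K] [Algebra R K] (s : Finset ι) (f : ι → K) (h : ∀ i ∈ s, IsAlgebraic R (f i)) :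
    IsAlgebraic R (∏ i ∈ s, f i) := by
  classical
  induction s using Finset.induction_on with
  | empty => simpa using isAlgebraic_one
  | insert i s hi ih =>
    rw [Finset.prod_insert hi]
    exact (h i (Finset.mem_insert_self i s)).mul (ih fun j hj => h j (Finset.mem_insert_of_mem hj))

/-- **Each parameter `sᵢ` is algebraic over `ℂ[τ]`**: `sᵢ = ∏ₗ (τₗ / cₗ) ^ Uᵢₗ` is a Laurent
monomial in elements of `ℂ[τ]`. [cite: BombieriGubler2006, Prop. 3.2.7 (proof)] -/
theorem isAlgebraic_paramS {U : Matrix (Fin n) (Fin n) ℤ} (hUU' : U * U' = 1)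
    (hc : c ∈ unitLocus ℂ n) (i : Fin n) :
    IsAlgebraic (Algebra.adjoin ℂ (Set.range (paramPt U' J c))) (paramS J i) := by
  set A : Subalgebra ℂ (ParamField n) := Algebra.adjoin ℂ (Set.range (paramPt U' J c)) with hA
  have hc' : ∀ l, algebraMap ℂ (ParamField n) (c l) ≠ 0 := fun l =>
    (map_ne_zero_iff _ (algebraMap ℂ (ParamField n)).injective).mpr (hc l)
  have hkey : paramS J i =
      ∏ l, (paramPt U' J c l * (algebraMap ℂ (ParamField n) (c l))⁻¹) ^ U i l := by
    rw [← prod_monomial_zpow_row hUU' (paramS J) (paramS_ne_zero J) i]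
    refine Finset.prod_congr rfl fun l _ => ?_
    rw [paramPt, mul_comm (algebraMap ℂ _ (c l)), mul_inv_cancel_right₀ (hc' l)]
  rw [hkey]
  refine isAlgebraic_finset_prod _ _ fun l _ => isAlgebraic_zpow ?_ _
  have hmem : paramPt U' J c l * (algebraMap ℂ (ParamField n) (c l))⁻¹ ∈ A :=
    A.mul_mem (Algebra.subset_adjoin ⟨l, rfl⟩) (by rw [← map_inv₀]; exact A.algebraMap_mem _)
  exact isAlgebraic_algebraMap (⟨_, hmem⟩ : A)

/-- **`trdeg_ℂ ℂ[τ] ≥ n - |J|`**: `ℂ[τ, s]` is algebraic over `ℂ[τ]` and contains the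
algebraically independent `Xⱼ`, `j ∉ J`. [cite: BombieriGubler2006, Prop. 3.2.7] -/
theorem le_trdeg_adjoin_paramPt {U : Matrix (Fin n) (Fin n) ℤ} (hUU' : U * U' = 1)
    (hc : c ∈ unitLocus ℂ n) :
    ((n - J.card : ℕ) : Cardinal) ≤
      Algebra.trdeg ℂ (Algebra.adjoin ℂ (Set.range (paramPt U' J c))) := by
  classical
  set A : Subalgebra ℂ (ParamField n) := Algebra.adjoin ℂ (Set.range (paramPt U' J c)) with hA
  set B : Subalgebra A (ParamField n) := Algebra.adjoin A (Set.range (paramS J)) with hB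
  -- `B` is algebraic over `A`
  haveI : Algebra.IsAlgebraic A B := by
    rw [← Subalgebra.isAlgebraic_iff, hB, Algebra.isAlgebraic_adjoin_iff]
    rintro _ ⟨i, rfl⟩
    exact isAlgebraic_paramS hUU' hc i
  haveI : FaithfulSMul ℂ A :=
    (faithfulSMul_iff_algebraMap_injective ℂ A).mpr (algebraMap ℂ A).injective
  haveI : FaithfulSMul A B :=
    (faithfulSMul_iff_algebraMap_injective A B).mpr fun a b h => Subtype.ext (by
      have := congrArg Subtype.val h
      exact this)
  have htower : Algebra.trdeg ℂ A + Algebra.trdeg A B = Algebra.trdeg ℂ B :=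
    _root_.trdeg_add_eq ℂ A (A := B)
  rw [_root_.trdeg_eq_zero (R := A) (A := B), add_zero] at htower
  rw [htower]
  -- the `Xⱼ`, `j ∉ J`, inside `B`
  set v : {j : Fin n // j ∉ J} → B := fun j =>
    ⟨paramS J j, Algebra.subset_adjoin ⟨j, rfl⟩⟩ with hv
  have hvind : AlgebraicIndependent ℂ v := by
    apply AlgebraicIndependent.of_comp (IsScalarTower.toAlgHom ℂ B (ParamField n))
    have h1 := ((algebraicIndependent_X (Fin n) ℂ).comp (fun j : {j : Fin n // j ∉ J} => j.1)
      Subtype.val_injective).map'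
      (f := IsScalarTower.toAlgHom ℂ (MvPolynomial (Fin n) ℂ) (ParamField n))
      (IsFractionRing.injective (MvPolynomial (Fin n) ℂ) (ParamField n))
    convert h1 using 1
    funext j
    simp only [Function.comp_apply, IsScalarTower.coe_toAlgHom', hv, paramS_of_not_mem J j.2]
    rfl
  have hcard : #({j : Fin n // j ∉ J}) = ((n - J.card : ℕ) : Cardinal) := by
    rw [Cardinal.mk_fintype, Fintype.card_subtype]
    have : (Finset.univ.filter fun j : Fin n => j ∉ J) = Jᶜ := by
      ext j; simp
    rw [this, Finset.card_compl, Fintype.card_fin]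
  rw [← hcard]
  exact hvind.cardinalMk_le_trdeg

end Param

/-! ### The dimension estimate -/

/-- **`dim (c · H_Λ) ≥ n - rk Λ`** in the form consumed by the weak CIT argument: for a pure
lattice `Λ` and `c ∈ (ℂˣ)ⁿ` there are mutually inverse integer matrices `U, U'` and indices `J`
with `Uⱼ ∈ Λ` for `j ∈ J` and `n ≤ zariskiDim ℂ (c · H_Λ) + |J|` (Bombieri–Gubler, Prop. 3.2.7:
`H_Λ` has dimension `n - rk Λ`; here `|J| = rk Λ` and only the lower bound is proved, through
`dim ≥ dim ℂ[Y]/ker (τ) = trdeg_ℂ ℂ[τ] ≥ n - |J|`). [cite: BombieriGubler2006, Prop. 3.2.7] -/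
theorem exists_unimodular_le_zariskiDim {Λ : AddSubgroup (Fin n → ℤ)}
    (hΛ : Λ.toAddSubmonoid.NSMulSaturated) {c : Fin n → ℂ} (hc : c ∈ unitLocus ℂ n) :
    ∃ (U U' : Matrix (Fin n) (Fin n) ℤ) (J : Finset (Fin n)),
      U * U' = 1 ∧ U' * U = 1 ∧ (∀ j ∈ J, U j ∈ Λ) ∧
        (n : WithBot ℕ∞) ≤ zariskiDim ℂ ((fun h => c * h) '' subgroupOfLattice ℂ Λ) + J.card := by
  obtain ⟨U, U', J, hUU', hU'U, hJ, hgen⟩ := exists_unimodular Λ hΛ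
  refine ⟨U, U', J, hUU', hU'U, hJ, ?_⟩
  set T := (fun h => c * h) '' subgroupOfLattice ℂ Λ with hT
  set φ := (aeval (paramPt U' J c) : MvPolynomial (Fin n) ℂ →ₐ[ℂ] ParamField n) with hφ
  -- `I(T) ≤ ker φ`
  have hle : vanishingIdeal ℂ T ≤ RingHom.ker φ := fun p hp => by
    rw [RingHom.mem_ker]
    exact aeval_paramPt_eq_zero hUU' hgen hp
  -- `dim ℂ[Y]/ker ≤ dim T`
  have h1 : ringKrullDim (MvPolynomial (Fin n) ℂ ⧸ RingHom.ker φ) ≤ zariskiDim ℂ T :=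
    ringKrullDim_le_of_surjective (Ideal.Quotient.factor hle) (Ideal.Quotient.factor_surjective hle)
  -- `dim ℂ[Y]/ker = trdeg ℂ[τ] ≥ n - |J|`
  haveI : (RingHom.ker φ).IsPrime := RingHom.ker_isPrime φ
  have h2 : ringKrullDim (MvPolynomial (Fin n) ℂ ⧸ RingHom.ker φ) =
      (Cardinal.toNat (Algebra.trdeg ℂ φ.range) : WithBot ℕ∞) := by
    rw [← zariskiDim_zeroLocus_eq, zariskiDim_zeroLocus_ker]
  haveI : Algebra.FiniteType ℂ φ.range :=
    Algebra.FiniteType.of_surjective φ.rangeRestrict (AlgHom.rangeRestrict_surjective φ)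
  have hfin : Algebra.trdeg ℂ φ.range = Cardinal.toNat (Algebra.trdeg ℂ φ.range) :=
    Literature.RingTheory.KrullDimension.trdeg_eq_toNat ℂ φ.range
  have h3 : n - J.card ≤ Cardinal.toNat (Algebra.trdeg ℂ φ.range) := by
    have h := le_trdeg_adjoin_paramPt (J := J) (c := c) hUU' hc
    rw [Algebra.adjoin_range_eq_range_aeval, ← hφ, hfin] at h
    exact_mod_cast h
  have h4 : ((n - J.card : ℕ) : WithBot ℕ∞) ≤ zariskiDim ℂ T := by
    refine le_trans ?_ (h2.symm.le.trans h1)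
    exact_mod_cast h3
  calc (n : WithBot ℕ∞) ≤ ((n - J.card : ℕ) : WithBot ℕ∞) + J.card := by
        have h5 : n ≤ n - J.card + J.card := le_tsub_add
        exact_mod_cast h5
    _ ≤ zariskiDim ℂ T + J.card := add_le_add h4 le_rfl


end Literature.NumberTheory.Transcendental.WeakCIT
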